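import Mathlib.Combinatorics.SimpleGraph.Coloring.Constructions
import Literature.Barriers.Parity.PrimePairParity
import HarnessLib

/-!
# Sign-pattern parity ghosts for a target graph of prime pairs
# (the Polymath 2014 §8 weight-insertion frame, from the edge/path to an arbitrary graph `T`)

`Literature/Barriers/Parity/SignGhost.lean` — companion of `PrimePairParity.lean` (barrier catalogue
entry `Literature.Barriers.Parity.PrimePairParity`, D-0021), requested by route
`TargetGraphParity` of `Parity / GeneralizedHardyLittlewood` (definition item `defn-HasSignGhost`).
All theorems here are PROVED; the file introduces no named fact.

## Setting

Fix `k` shifts `h : Fin k → ℕ` (the linear forms `n + h i`) and a TARGET GRAPH `T` on `Fin k`.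
The target set is `edgePrimeSet T h = {n | some edge ij of T has n + h i and n + h j both prime}`:
`T = K₂` on `Fin 2` with `h = (0, 2)` is the twin set (`edgePrimeSet_top_two`), the path `0–2–6`
is Polymath's `A'` behind `H₁ ≤ 4`, and Remark 8.1 of the source uses the pair graph
`{i i' : i' - i ≤ 4, (n+i, 3) = (n+i', 3) = 1}` on `[0, H]`.

Polymath's §8 argument [cite: Polymath8b2014, §8 (pp. 35–36)] inserts a non-negative weight
`ω(n)` that is a polynomial in the signs `λ(n + h i)` (`λ` the Liouville function, `λ(p) = -1`):
`1 - λ(n)λ(n+2)` for twins, `(1 - λ(n)λ(n+2))(1 - λ(n+2)λ(n+6))` for `A'`, and in Remark 8.1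
"one uses the weight `ω(n) := ∏_{0 ≤ i ≤ i' ≤ H; (n+i,3) = (n+i',3) = 1; i'-i ≤ 4}
(1 - λ(n+i) λ(n+i'))`". Such a weight is a function `P` of the SIGN PATTERN
`ε i := [λ(n + h i) = -1]` (`signPatternWeight P h`); it annihilates the target set as soon as
`P` vanishes on every pattern whose `true`-set contains an edge of `T` (at a prime, `λ = -1`), and
then every `ω`-weighted detection sum `∑ ν 1_A ω` is `0`, so no weight-insertion-invariant
deduction (`Literature.Barriers.Parity.IsSieveTheoreticDeduction`, the technique class of
`PrimePairParity`) can produce an element of the target set from inputs that `ω` also enjoys —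
`signGhost_schema`, proved exactly as `PrimePairParity_holds`.

## The ghost linear programme

Which `P ≥ 0` are candidates? The route's frame (card `bipartite-parity-criterion`) asks, besides
non-negativity, positive mass and the killing condition, for BALANCED one-variable marginals:
for every `i`, the `P`-mass of `{ε i = true}` equals the `P`-mass of `{ε i = false}` (no degree-1
Walsh–Fourier mass, the part of `ω` visible to one-prime distributional inputs). This is the
predicate `HasSignGhost T` below, stated LITERALLY as inlined in the route's items
`BipartiteCriterion` / `ExactlyBipartite` (so that `HasSignGhost T ↔ …` is `Iff.rfl` there).

Normalising the mass to `1`, a sign ghost is a probability measure on `T`-independent sets (the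
`true`-sets) under which every vertex has marginal `1/2`, i.e. the point `(½, …, ½)` of the
stable-set polytope of `T`; such a measure exists iff `T` is bipartite (odd-cycle inequalities
`x(C) ≤ (|C| - 1)/2`, cf. [GrotschelLovaszSchrijver1981]; here proved directly):
`hasSignGhost_iff_colorable_two`.
* `⇐` (`HasSignGhost.of_colorable_two`): for a proper 2-colouring with sign pattern `σ`, the CUT
  GHOST `P = 1[ε = σ] + 1[ε = ¬σ]` works (colour classes are independent; the flip symmetry
  `flipPattern` balances the marginals, `sum_ite_eq_of_flip_invariant`).
* `⇒` (`HasSignGhost.colorable_two`): by Mathlib's `SimpleGraph.two_colorable_iff_forall_loop_even`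
  it suffices that every closed walk has even length; along a closed walk of odd length `L` an
  independent `true`-set occupies at most `(L-1)/2` of the `L` cyclic positions
  (`two_mul_trueCount_succ_le_length`), while balanced marginals make the `P`-average number of
  `true` positions exactly `L/2` — contradiction with positive mass.

## Design notes

* `liouvilleR 0 = 0` (Mathlib's arithmetic functions vanish at `0`), so the sign pattern of `n`
  is `[λ = -1]`, not "`λ = -1` versus `λ = +1`"; this is irrelevant for the schema (only primes
  matter) and for the LP (which is about `P`, not about `λ`).
* `twinParityWeight` / `gapFourParityWeight` of `PrimePairParity.lean` are the cases `T = K₂`,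
  path; we do not restate them (for `n ≥ 1` they equal `2 · 1[ε 0 ≠ ε 1]`, resp. a product of
  two such factors, as functions of the pattern).
* Imports: `PrimePairParity` (for `liouvilleR`, `weightedDetectionSum`,
  `IsSieveTheoreticDeduction`, `twinSet`) and Mathlib's colouring constructions only.
* What is NOT here: any claim about which input classes `Inputs` the ghosts satisfy (the
  conjectural Möbius-randomness half of §8, see the `[status: open]` conjectures in
  `PrimePairParity.lean`), hypergraph targets, affine forms `a i * n + b i`.
-/

noncomputable section

open Finset

namespace Literature.Barriers.Parity

variable {k : ℕ}

/-! ### The ghost LP: `HasSignGhost` -/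

/-- **Sign ghost for a target graph.** `HasSignGhost T` says that the ghost linear programme of
the target graph `T` on `Fin k` is feasible: there is a function `P` of the sign pattern
`ε : Fin k → Bool` (`true` = "`λ(n + h i) = -1`") which is non-negative, has positive total
mass, vanishes on every pattern whose `true`-set contains an edge of `T` (so that the weight
`signPatternWeight P h` annihilates `edgePrimeSet T h`), and has balanced one-variable marginals:
for every `i`, `∑_{ε : ε i} P ε = ∑_{ε : ¬ ε i} P ε` (no degree-one Walsh mass). Stated literally
as inlined in route `TargetGraphParity` (items `BipartiteCriterion`, `ExactlyBipartite`).
Equivalent to `T.Colorable 2` (`hasSignGhost_iff_colorable_two`). The weights of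
[Polymath8b2014, §8 and Remark 8.1] are the cases `T = K₂`, the path `0–2–6`, and the pair graph
of Remark 8.1. [folklore] -/
def HasSignGhost (T : SimpleGraph (Fin k)) : Prop :=
  ∃ P : (Fin k → Bool) → ℝ, (∀ ε, 0 ≤ P ε) ∧ 0 < ∑ ε, P ε ∧
    (∀ ε, (∃ i j, T.Adj i j ∧ ε i = true ∧ ε j = true) → P ε = 0) ∧
    ∀ i, ∑ ε, (if ε i then P ε else 0) = ∑ ε, (if ε i then 0 else P ε)

/-- Unfolding lemma for `HasSignGhost` (definitional). [folklore] -/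
theorem hasSignGhost_iff (T : SimpleGraph (Fin k)) :
    HasSignGhost T ↔
      ∃ P : (Fin k → Bool) → ℝ, (∀ ε, 0 ≤ P ε) ∧ 0 < ∑ ε, P ε ∧
        (∀ ε, (∃ i j, T.Adj i j ∧ ε i = true ∧ ε j = true) → P ε = 0) ∧
        ∀ i, ∑ ε, (if ε i then P ε else 0) = ∑ ε, (if ε i then 0 else P ε) :=
  Iff.rfl

/-! ### Sign-pattern weights and edge-prime target sets (Polymath 2014, §8 and Remark 8.1) -/

/-- **The sign-pattern weight** `ω(n) = P(ε(n))`, where `ε(n) i := [λ(n + h i) = -1]` is the sign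
pattern of the shifted Liouville values. Polymath's `1 - λ(n)λ(n+2)`,
`(1 - λ(n)λ(n+2))(1 - λ(n+2)λ(n+6))` and the product weight of Remark 8.1 are of this form for
`n ≥ 1`. [cite: Polymath8b2014, §8 (p. 35) and Remark 8.1] -/
def signPatternWeight (P : (Fin k → Bool) → ℝ) (h : Fin k → ℕ) (n : ℕ) : ℝ :=
  P (fun i => decide (liouvilleR (n + h i) = -1))

/-- **The edge-prime target set** of a target graph `T` and shifts `h`:
`{n | ∃ edge ij of T, n + h i and n + h j both prime}` — the set whose infinitude is the
disjunction "some edge of `T` is a prime pair infinitely often" (twins for `T = K₂`, `h = (0,2)`;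
Polymath's `A'` for the path `0–2–6`; `A_H = {n : ∃ n ≤ p₁ < p₂ ≤ n + H both prime, p₂ - p₁ ≤ 4}`
of Remark 8.1 for the graph on the shifts `0, …, H` joining shifts at distance `≤ 4`).
[cite: Polymath8b2014, §8 (8.7) and Remark 8.1] -/
def edgePrimeSet (T : SimpleGraph (Fin k)) (h : Fin k → ℕ) : Set ℕ :=
  {n | ∃ i j, T.Adj i j ∧ (n + h i).Prime ∧ (n + h j).Prime}

/-- Membership in `edgePrimeSet` (definitional). [folklore] -/
theorem mem_edgePrimeSet {T : SimpleGraph (Fin k)} {h : Fin k → ℕ} {n : ℕ} :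
    n ∈ edgePrimeSet T h ↔ ∃ i j, T.Adj i j ∧ (n + h i).Prime ∧ (n + h j).Prime :=
  Iff.rfl

/-- A non-negative `P` gives a non-negative weight (a legitimate sieve insertion).
[cite: Polymath8b2014, §8 (p. 35)] -/
theorem signPatternWeight_nonneg {P : (Fin k → Bool) → ℝ} (hP : ∀ ε, 0 ≤ P ε) (h : Fin k → ℕ)
    (n : ℕ) : 0 ≤ signPatternWeight P h n :=
  hP _

/-- At a prime value of the form `n + h i` the `i`-th sign is `true` (`λ(p) = -1`). [folklore] -/
theorem signPattern_of_prime {h : Fin k → ℕ} {n : ℕ} {i : Fin k} (hp : (n + h i).Prime) :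
    decide (liouvilleR (n + h i) = -1) = true :=
  decide_eq_true (liouvilleR_prime hp)

/-- **The ghost annihilates the target set**: if `P` vanishes on every pattern whose `true`-set
contains an edge of `T`, then `signPatternWeight P h n = 0` for every `n ∈ edgePrimeSet T h`
("Observe that `ω` vanishes for any `n ∈ A'`"). [cite: Polymath8b2014, §8 (8.9) and Remark 8.1] -/
theorem signPatternWeight_eq_zero {T : SimpleGraph (Fin k)} {P : (Fin k → Bool) → ℝ}
    (hkill : ∀ ε, (∃ i j, T.Adj i j ∧ ε i = true ∧ ε j = true) → P ε = 0) {h : Fin k → ℕ}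
    {n : ℕ} (hn : n ∈ edgePrimeSet T h) : signPatternWeight P h n = 0 := by
  obtain ⟨i, j, hij, hi, hj⟩ := hn
  exact hkill _ ⟨i, j, hij, signPattern_of_prime hi, signPattern_of_prime hj⟩

/-- For EVERY sieve weight `ν` and every scale, the ghost-weighted detection sum of the target set
vanishes (Polymath's (8.9), for a general target graph). [cite: Polymath8b2014, §8 (8.9)] -/
theorem weightedDetectionSum_signPatternWeight {T : SimpleGraph (Fin k)} {P : (Fin k → Bool) → ℝ}
    (hkill : ∀ ε, (∃ i j, T.Adj i j ∧ ε i = true ∧ ε j = true) → P ε = 0) (h : Fin k → ℕ)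
    (ν : ℕ → ℝ) (x : ℕ) :
    weightedDetectionSum ν (edgePrimeSet T h) (signPatternWeight P h) x = 0 := by
  classical
  refine Finset.sum_eq_zero fun n _ => ?_
  by_cases hn : n ∈ edgePrimeSet T h
  · rw [signPatternWeight_eq_zero hkill hn, mul_zero]
  · rw [Set.indicator_of_notMem hn, mul_zero, zero_mul]

/-- **Ghost schema (the `T`-generalisation of `PrimePairParity_holds`).** For every target graph
`T`, shifts `h` and every `P ≥ 0` vanishing on the patterns whose `true`-set contains a `T`-edge,
the weight `ω = signPatternWeight P h` defeats every weight-insertion-invariant deduction of the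
`T`-disjunction: relative to any input class `Inputs` that `ω` satisfies, there is no
sieve-theoretic deduction of an element of `edgePrimeSet T h` — because every `ω`-weighted
detection sum is `0`. Binders in the order of route item `GhostSchema`.
[cite: Polymath8b2014, §8 (pp. 35–36) and Remark 8.1] -/
theorem signGhost_schema (k : ℕ) (T : SimpleGraph (Fin k)) (h : Fin k → ℕ)
    (P : (Fin k → Bool) → ℝ) (hP : ∀ ε, 0 ≤ P ε)
    (hkill : ∀ ε, (∃ i j, T.Adj i j ∧ ε i = true ∧ ε j = true) → P ε = 0)
    (Inputs : (ℕ → ℝ) → Prop) (hIn : Inputs (signPatternWeight P h)) :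
    ¬ IsSieveTheoreticDeduction Inputs (edgePrimeSet T h) := by
  intro hded
  obtain ⟨x, ν, -, hpos⟩ := hded _ (signPatternWeight_nonneg hP h) hIn
  rw [weightedDetectionSum_signPatternWeight hkill] at hpos
  exact lt_irrefl 0 hpos

/-- Consistency with `PrimePairParity.lean`: for `T = K₂` on `Fin 2` and shifts `(0, 2)` the
edge-prime set is the twin set `{n | n, n + 2 prime}`. [cite: Polymath8b2014, §8 (p. 36)] -/
theorem edgePrimeSet_top_two : edgePrimeSet (⊤ : SimpleGraph (Fin 2)) ![0, 2] = twinSet := by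
  ext n
  simp only [mem_edgePrimeSet, twinSet, Set.mem_setOf_eq, SimpleGraph.top_adj]
  constructor
  · rintro ⟨i, j, hij, hi, hj⟩
    fin_cases i <;> fin_cases j <;> simp_all
  · rintro ⟨h0, h2⟩
    exact ⟨0, 1, by decide, by simpa using h0, by simpa using h2⟩

/-! ### The criterion: a sign ghost exists iff the target graph is bipartite -/

/-- The global sign flip `ε ↦ ¬ε` of a sign pattern (the symmetry `λ ↦ -λ` of the ghost LP).
[folklore] -/
def flipPattern (ε : Fin k → Bool) : Fin k → Bool := fun i => !ε i

/-- `flipPattern` pointwise. [folklore] -/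
@[simp] theorem flipPattern_apply (ε : Fin k → Bool) (i : Fin k) : flipPattern ε i = !ε i := rfl

/-- Flipping all signs is an involution of the pattern space. [folklore] -/
@[simp] theorem flipPattern_flipPattern (ε : Fin k → Bool) : flipPattern (flipPattern ε) = ε := by
  funext j; simp [flipPattern]

/-- `flipPattern ε = σ ↔ ε = flipPattern σ`. [folklore] -/
theorem flipPattern_eq_iff (ε σ : Fin k → Bool) : flipPattern ε = σ ↔ ε = flipPattern σ := by
  constructor
  · rintro rfl; exact (flipPattern_flipPattern ε).symm
  · rintro rfl; exact flipPattern_flipPattern σ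

/-- A flip-invariant `P` has balanced one-variable marginals. [folklore] -/
theorem sum_ite_eq_of_flip_invariant (P : (Fin k → Bool) → ℝ)
    (hP : ∀ ε, P (flipPattern ε) = P ε) (i : Fin k) :
    ∑ ε, (if ε i then P ε else 0) = ∑ ε, (if ε i then 0 else P ε) := by
  have hbij : Function.Bijective (flipPattern (k := k)) :=
    Function.Involutive.bijective fun ε => flipPattern_flipPattern ε
  refine (Fintype.sum_bijective _ hbij (fun ε => if ε i then 0 else P ε)
    (fun ε => if ε i then P ε else 0) fun ε => ?_).symm
  cases hε : ε i <;> simp [hε, hP]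

/-- **`⇐`: bipartite target graphs carry a sign ghost** — the cut ghost
`P = 1[ε = σ] + 1[ε = ¬σ]` of a proper 2-colouring `σ` (colour classes are independent, the flip
symmetry balances the marginals). For `n ≥ 1` (all `λ(n + h i) = ±1`) Polymath's weights are of
this kind: `1 - λ(n)λ(n+2) = 2 · 1[ε 0 ≠ ε 1]` is twice the cut ghost of `K₂`, and
`(1 - λ(n)λ(n+2))(1 - λ(n+2)λ(n+6)) = 4 · 1[ε 0 ≠ ε 1] 1[ε 1 ≠ ε 2]` four times the cut ghost of
the path (Polymath8b2014 §8); Remark 8.1 there uses the analogous product weight over a pair graph.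
[folklore] -/
theorem HasSignGhost.of_colorable_two {T : SimpleGraph (Fin k)} (hT : T.Colorable 2) :
    HasSignGhost T := by
  classical
  obtain ⟨C⟩ := hT
  -- the sign pattern of the colouring: `true` on colour `0`
  set σ : Fin k → Bool := fun i => decide (C i = 0) with hσ
  refine ⟨fun ε => (if ε = σ then 1 else 0) + (if ε = flipPattern σ then 1 else 0),
    ?_, ?_, ?_, ?_⟩
  · intro ε
    show (0 : ℝ) ≤ (if ε = σ then 1 else 0) + (if ε = flipPattern σ then 1 else 0)
    split_ifs <;> norm_num
  · simp only [Finset.sum_add_distrib, Fintype.sum_ite_eq']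
    norm_num
  · rintro ε ⟨i, j, hij, hi, hj⟩
    have hC : C i ≠ C j := C.valid hij
    have hεσ : ε ≠ σ := by
      rintro rfl
      simp only [hσ, decide_eq_true_eq] at hi hj
      exact hC (hi.trans hj.symm)
    have hετ : ε ≠ flipPattern σ := by
      rintro rfl
      simp [hσ] at hi hj
      exact hC ((Fin.eq_one_of_ne_zero _ hi).trans (Fin.eq_one_of_ne_zero _ hj).symm)
    simp [hεσ, hετ]
  · refine sum_ite_eq_of_flip_invariant _ (fun ε => ?_)
    show ((if flipPattern ε = σ then (1 : ℝ) else 0) + if flipPattern ε = flipPattern σ then 1 else 0) =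
      (if ε = σ then 1 else 0) + if ε = flipPattern σ then 1 else 0
    simp only [flipPattern_eq_iff, flipPattern_flipPattern]
    rw [add_comm]

/-- **Odd closed walks versus independent `true`-sets.** Along a closed walk `w` of odd length `L`
in `T`, a pattern `ε` whose `true`-set contains no edge of `T` is `true` at no two cyclically
consecutive positions, hence at most `(L - 1)/2` of the `L` positions `w(0), …, w(L-1)` are `true`:
`2 · #{j < L : ε (w j)} + 1 ≤ L`. [folklore] -/
theorem two_mul_trueCount_succ_le_length {T : SimpleGraph (Fin k)} {u : Fin k} (w : T.Walk u u)
    (ε : Fin k → Bool) (hε : ¬ ∃ i j, T.Adj i j ∧ ε i = true ∧ ε j = true)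
    (hodd : Odd w.length) :
    2 * (∑ j ∈ range w.length, if ε (w.getVert j) = true then 1 else 0) + 1 ≤ w.length := by
  set a : ℕ → ℕ := fun j => if ε (w.getVert j) = true then 1 else 0 with ha
  -- consecutive positions carry adjacent vertices, hence are not both `true`
  have hstep : ∀ j, j < w.length → a j + a (j + 1) ≤ 1 := by
    intro j hj
    have hadj := w.adj_getVert_succ hj
    simp only [ha]
    split_ifs with h1 h2
    · exact (hε ⟨_, _, hadj, h1, h2⟩).elim
    all_goals simp
  -- the walk is closed, so the shifted count equals the count
  have h0 : a w.length = a 0 := by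
    simp only [ha, w.getVert_length, w.getVert_zero]
  have hshift : ∑ j ∈ range w.length, a (j + 1) = ∑ j ∈ range w.length, a j := by
    have h1 := Finset.sum_range_succ' a w.length
    have h2 := Finset.sum_range_succ a w.length
    omega
  have hle : ∑ j ∈ range w.length, (a j + a (j + 1)) ≤ ∑ _j ∈ range w.length, 1 :=
    Finset.sum_le_sum fun j hj => hstep j (Finset.mem_range.mp hj)
  rw [Finset.sum_add_distrib, hshift, Finset.sum_const, Finset.card_range, smul_eq_mul,
    mul_one] at hle
  obtain ⟨m, hm⟩ := hodd
  change 2 * (∑ j ∈ range w.length, a j) + 1 ≤ w.length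
  omega

/-- **`⇒`: a sign ghost forces the target graph to be bipartite.** If `P` is a sign ghost for `T`
then every closed walk of `T` has even length (hence `T.Colorable 2` by
`SimpleGraph.two_colorable_iff_forall_loop_even`): along a closed walk of odd length `L`, each
pattern in the support of `P` is `true` at `≤ (L-1)/2` positions
(`two_mul_trueCount_succ_le_length`), whereas the balanced marginals make the `P`-weighted number
of `true` positions equal to `L/2` times the (positive) total mass. Equivalently: `(½, …, ½)` lies
in the stable-set polytope of `T` only if `T` has no odd cycle (odd-cycle inequalities,
cf. [GrotschelLovaszSchrijver1981]). [folklore] -/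
theorem HasSignGhost.colorable_two {T : SimpleGraph (Fin k)} (hT : HasSignGhost T) :
    T.Colorable 2 := by
  obtain ⟨P, hP0, hpos, hkill, hbal⟩ := hT
  rw [SimpleGraph.two_colorable_iff_forall_loop_even]
  intro u w
  by_contra hodd
  rw [Nat.not_even_iff_odd] at hodd
  -- balanced marginals: every one-variable marginal is half the total mass
  have hmarg : ∀ i, 2 * ∑ ε, (if ε i then P ε else 0) = ∑ ε, P ε := by
    intro i
    have hsum : ∑ ε, (if ε i then P ε else 0) + ∑ ε, (if ε i then 0 else P ε) = ∑ ε, P ε := by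
      rw [← Finset.sum_add_distrib]
      refine Finset.sum_congr rfl fun ε _ => ?_
      split_ifs <;> simp
    have := hbal i
    linarith
  -- pointwise: `P ε · (2 N(ε) + 1) ≤ P ε · L`, `N(ε)` the number of `true` positions on the walk
  have hpt : ∀ ε, P ε * (2 * (∑ j ∈ range w.length,
      (if ε (w.getVert j) = true then (1 : ℝ) else 0)) + 1) ≤ P ε * w.length := by
    intro ε
    by_cases hε : ∃ i j, T.Adj i j ∧ ε i = true ∧ ε j = true
    · simp [hkill ε hε]
    · refine mul_le_mul_of_nonneg_left ?_ (hP0 ε)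
      exact_mod_cast two_mul_trueCount_succ_le_length w ε hε hodd
  -- expectation: `∑_ε P ε · N(ε) = L · (total mass) / 2`
  have hexp : ∑ ε, P ε * (∑ j ∈ range w.length, (if ε (w.getVert j) = true then (1 : ℝ) else 0)) =
      w.length * (∑ ε, P ε) / 2 := by
    have hrw : ∀ ε, P ε * (∑ j ∈ range w.length, (if ε (w.getVert j) = true then (1 : ℝ) else 0)) =
        ∑ j ∈ range w.length, (if ε (w.getVert j) then P ε else 0) := by
      intro ε
      rw [Finset.mul_sum]
      refine Finset.sum_congr rfl fun j _ => ?_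
      split_ifs <;> simp
    simp_rw [hrw]
    rw [Finset.sum_comm]
    have hcol : ∀ j ∈ range w.length,
        ∑ ε, (if ε (w.getVert j) then P ε else 0) = (∑ ε, P ε) / 2 := by
      intro j _
      have := hmarg (w.getVert j)
      linarith
    rw [Finset.sum_congr rfl hcol, Finset.sum_const, Finset.card_range, nsmul_eq_mul]
    ring
  -- sum the pointwise bounds and compare
  have hsum := Finset.sum_le_sum fun ε (_ : ε ∈ (Finset.univ : Finset (Fin k → Bool))) => hpt ε
  have hlhs : ∑ ε, P ε * (2 * (∑ j ∈ range w.length,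
      (if ε (w.getVert j) = true then (1 : ℝ) else 0)) + 1) =
      w.length * (∑ ε, P ε) + ∑ ε, P ε := by
    have : ∀ ε, P ε * (2 * (∑ j ∈ range w.length,
        (if ε (w.getVert j) = true then (1 : ℝ) else 0)) + 1) =
        2 * (P ε * ∑ j ∈ range w.length, (if ε (w.getVert j) = true then (1 : ℝ) else 0)) +
          P ε := by
      intro ε; ring
    simp_rw [this]
    rw [Finset.sum_add_distrib, ← Finset.mul_sum, hexp]
    ring
  have hrhs : ∑ ε, P ε * (w.length : ℝ) = w.length * ∑ ε, P ε := by
    rw [← Finset.sum_mul, mul_comm]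
  rw [hlhs, hrhs] at hsum
  linarith

/-- **Bipartite criterion.** A target graph carries a sign ghost iff it is 2-colourable
(route item `BipartiteCriterion` reads `∀ k T, HasSignGhost T ↔ T.Colorable 2`). [folklore] -/
theorem hasSignGhost_iff_colorable_two (T : SimpleGraph (Fin k)) :
    HasSignGhost T ↔ T.Colorable 2 :=
  ⟨HasSignGhost.colorable_two, HasSignGhost.of_colorable_two⟩

/-- In particular the parity obstruction of this frame applies to the single edge (twins: `K₂` is
bipartite) but NOT to the triangle `K₃` (three forms, "two of them prime": not 2-colourable), in
accordance with `H₁ ≤ 6` under GEH escaping §8. [cite: Polymath8b2014, §8 (p. 35)] -/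
theorem not_hasSignGhost_top_three : ¬ HasSignGhost (⊤ : SimpleGraph (Fin 3)) := by
  intro h
  -- a 2-colouring of `K₃` would inject three pairwise adjacent vertices into two colours
  have h3 := h.colorable_two.card_le_of_pairwise_adj id
    (fun i j hij => (SimpleGraph.top_adj i j).mpr hij)
  simp at h3

end Literature.Barriers.Parity
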